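import Summits.CriticalPhenomena.CardyFormulaZ2.Theorems.CardyMagicRigidityNestingRigidityNeckBridgeStructure
import Mathlib.Data.Set.Card
import HarnessLib

/-!
# Crux `NestingRigidity`, line `pinch-resampling` (v4), stub S11: the necklace of real clusters along a needed family — generic chain form

Crux `Summit.CriticalPhenomena.CardyFormulaZ2.Theses.CardyMagicRigidity.NestingRigidity` (stmt-CriticalPhenomena-4835),
line `pinch-resampling` v4, stub S11 `stub_neckHookupCoarseT : NeckHookupCoarseT` (and S12).  Worker W6c, wave 6; sequel of
`…NeckBridgeStructure`, generic form of `…NeckZ2CoveringAChain` (worker W1, p165454), from which everything is adapted.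

For a family `F` of virtual edges over which `b, b'` are chained in the augmentation `NeckBridge.bAugSteps H O F` and every
edge of which is needed, the `b`-sides `S_e` are pairwise distinct and nested, so `F` is linearly ordered by `S_e`; every
edge has an inner endpoint `inP e ∈ S_e` and an outer endpoint `outP e ∉ S_e`; and the real `H`-clusters of `O` met along the
order form a NECKLACE: `b ⟶ inP e_min`, `outP e ⟶ inP e'` for consecutive `e < e'`, `outP e_max ⟶ b'`, while `b ≁ outP e`
and `outP e ≁ outP e'` (`e < e'`) — the clusters are pairwise distinct.

* §1 `side`, `side_ne_side`, `exists_endpoints`, `out_mem_side`, `in_not_mem_side`.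
* §2 The necklace: `pathIn_inP_of_isMin`, `pathIn_outP_of_isMax`, `pathIn_outP_inP_of_covBy`, `not_pathIn_b_outP`,
  `not_pathIn_outP_outP_of_lt`.
* §3 Ranks (`side_subset_iff_ncard_le`, for finite `O`) and the packaged chain form `NeckBridge.exists_rank_of_needed`
  (closed form `bridge_exists_rank_of_needed`, registered anchor).
-/

namespace Summit.CriticalPhenomena.CardyFormulaZ2.Cruxes.NestingRigidity.PinchResampling

open Set Literature.Probability.Percolation

namespace NeckBridge

variable {V : Type*} {H : SimpleGraph V} {O : Set V}

/-! ## §1 Sides are distinct; inner and outer endpoints -/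

/-- The `b`-side of the virtual edge `e`: the points chained to `b` over `F ∖ {e}`. -/
def side (H : SimpleGraph V) (O : Set V) (F : Set (V × V)) (b : V) (e : V × V) : Set V :=
  {v | Relation.ReflTransGen (fun a c ↦ (a, c) ∈ bAugSteps H O (F \ {e})) b v}

/-- Membership in a side. -/
@[simp] theorem mem_side {F : Set (V × V)} {b : V} {e : V × V} {v : V} :
    v ∈ side H O F b e ↔ Relation.ReflTransGen (fun a c ↦ (a, c) ∈ bAugSteps H O (F \ {e})) b v := Iff.rfl

variable {F : Set (V × V)} {b b' : V}

/-- **The sides of two distinct needed edges are distinct.** -/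
theorem side_ne_side (hconn : Relation.ReflTransGen (fun a c ↦ (a, c) ∈ bAugSteps H O F) b b')
    {e e' : V × V} (he : b' ∉ side H O F b e) (he' : b' ∉ side H O F b e') (hne : e ≠ e') :
    side H O F b e ≠ side H O F b e' := by
  intro hS
  obtain ⟨y, z, hy, hz, hyz, -⟩ := bAugChain_exists_step_out (P := side H O F b e) hconn
    Relation.ReflTransGen.refl he
  have hor := step_eq_of_exit hyz hy hz
  rw [hS] at hy hz
  have hor' := step_eq_of_exit hyz hy hz
  have h1 := ne_swap_of_needed hconn he he' hne
  have h2 := ne_swap_of_needed hconn he' he hne.symm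
  rcases hor with h | h <;> rcases hor' with h' | h'
  · exact hne (h.symm.trans h')
  · exact h1 (by rw [← h', ← h])
  · exact h2 (by rw [← h, ← h'])
  · exact hne (h.symm.trans h')

/-- **Inner and outer endpoints**: a needed edge has one endpoint in its side and the other outside. -/
theorem exists_endpoints (hconn : Relation.ReflTransGen (fun a c ↦ (a, c) ∈ bAugSteps H O F) b b')
    {e : V × V} (he : b' ∉ side H O F b e) :
    ∃ y z, ((y, z) = e ∨ (z, y) = e) ∧ y ∈ side H O F b e ∧ z ∉ side H O F b e := by
  obtain ⟨y, z, hy, hz, hyz, -⟩ := bAugChain_exists_step_out (P := side H O F b e) hconn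
    Relation.ReflTransGen.refl he
  exact ⟨y, z, step_eq_of_exit hyz hy hz, hy, hz⟩

/-- An edge of `F`, in either orientation, is a step of the augmentation by `F`. -/
theorem step_of_endpoints {e : V × V} (heF : e ∈ F) {y z : V} (hor : (y, z) = e ∨ (z, y) = e) :
    (y, z) ∈ bAugSteps H O F := by
  rcases hor with h | h
  · exact Or.inr (Or.inl (h ▸ heF))
  · exact Or.inr (Or.inr (h ▸ heF))

/-- The outer endpoint of `e` lies in the side of every other needed edge `e'` whose side contains that of `e`. -/
theorem out_mem_side (hconn : Relation.ReflTransGen (fun a c ↦ (a, c) ∈ bAugSteps H O F) b b')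
    {e e' : V × V} (he : b' ∉ side H O F b e) (he' : b' ∉ side H O F b e') (hne : e ≠ e')
    (hS : side H O F b e ⊆ side H O F b e') {y z : V} (hor : (y, z) = e ∨ (z, y) = e)
    (hy : y ∈ side H O F b e) : z ∈ side H O F b e' :=
  Relation.ReflTransGen.tail (hS hy)
    (step_mem_diff_of_needed hconn he he' hne (step_of_endpoints (mem_of_needed hconn he) hor) hor)

/-- The inner endpoint of `e'` lies outside the side of every other needed edge `e` whose side is contained in that
of `e'`. -/
theorem in_not_mem_side (hconn : Relation.ReflTransGen (fun a c ↦ (a, c) ∈ bAugSteps H O F) b b')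
    {e e' : V × V} (he : b' ∉ side H O F b e) (he' : b' ∉ side H O F b e') (hne : e' ≠ e)
    (hS : side H O F b e ⊆ side H O F b e') {y z : V} (hor : (y, z) = e' ∨ (z, y) = e')
    (hz : z ∉ side H O F b e') : y ∉ side H O F b e := fun hy ↦
  hz (hS (Relation.ReflTransGen.tail hy
    (step_mem_diff_of_needed hconn he' he hne (step_of_endpoints (mem_of_needed hconn he') hor) hor)))

/-! ## §2 The necklace of open clusters -/

/-- **Last exit**: a chain over `G` from a point of `P` to a point outside `P` has a last step leaving `P`, after
which it stays outside `P`. -/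
theorem exists_last_exit {G : Set (V × V)} {P : Set V} {a v : V}
    (h : Relation.ReflTransGen (fun a c ↦ (a, c) ∈ bAugSteps H O G) a v) (ha : a ∈ P) (hv : v ∉ P) :
    ∃ y z, y ∈ P ∧ z ∉ P ∧ (y, z) ∈ bAugSteps H O G ∧
      Relation.ReflTransGen (fun a c ↦ (a, c) ∈ bAugSteps H O G) a y ∧
      Relation.ReflTransGen (fun p q ↦ (p, q) ∈ bAugSteps H O G ∧ p ∉ P ∧ q ∉ P) z v := by
  induction h with
  | refl => exact (hv ha).elim
  | @tail y z hay hyz ih =>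
    by_cases hy : y ∈ P
    · exact ⟨y, z, hy, hv, hyz, hay, Relation.ReflTransGen.refl⟩
    · obtain ⟨y', z', hy', hz', hs, hc, hrest⟩ := ih hy
      exact ⟨y', z', hy', hz', hs, hc, hrest.tail ⟨hyz, hy, hv⟩⟩

/-- Every chain from `a` is a chain all of whose points are chained to `a`. -/
theorem bAugChain_restrict {G : Set (V × V)} {a v : V}
    (h : Relation.ReflTransGen (fun a c ↦ (a, c) ∈ bAugSteps H O G) a v) :
    Relation.ReflTransGen (fun p q ↦ (p, q) ∈ bAugSteps H O G ∧
      ¬ ¬ Relation.ReflTransGen (fun a c ↦ (a, c) ∈ bAugSteps H O G) a p ∧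
      ¬ ¬ Relation.ReflTransGen (fun a c ↦ (a, c) ∈ bAugSteps H O G) a q) a v := by
  induction h with
  | refl => exact Relation.ReflTransGen.refl
  | @tail y z hay hyz ih => exact ih.tail ⟨hyz, not_not_intro hay, not_not_intro (hay.tail hyz)⟩

/-- **Real bands**: a chain over `G` staying outside `P`, all of whose steps outside `P` are real open edges of
`O`, is an open path of `O`. -/
theorem pathIn_of_restricted {G : Set (V × V)} {P : Set V} {z v : V}
    (h : Relation.ReflTransGen (fun p q ↦ (p, q) ∈ bAugSteps H O G ∧ p ∉ P ∧ q ∉ P) z v)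
    (hz : z ∈ O)
    (hreal : ∀ p q, (p, q) ∈ bAugSteps H O G → p ∉ P → q ∉ P → H.Adj p q ∧ q ∈ O) :
    PathIn H O z v := by
  induction h with
  | refl => exact PathIn.refl hz
  | @tail p q _ hpq ih =>
    obtain ⟨hadj, hq⟩ := hreal p q hpq.1 hpq.2.1 hpq.2.2
    exact ih.tail hadj hq

/-- **Steps of the lowest band are real**: for the edge of smallest side, a step between two points of its side is
a real open edge. -/
theorem real_of_step_below (hconn : Relation.ReflTransGen (fun a c ↦ (a, c) ∈ bAugSteps H O F) b b')
    (hneeded : ∀ e ∈ F, b' ∉ side H O F b e) {e₀ : V × V} (he₀ : e₀ ∈ F)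
    (hmin : ∀ e ∈ F, side H O F b e₀ ⊆ side H O F b e) {p q : V}
    (hpq : (p, q) ∈ bAugSteps H O (F \ {e₀})) (hp : p ∈ side H O F b e₀) :
    H.Adj p q ∧ q ∈ O := by
  rcases hpq with ⟨hadj, -, hq⟩ | hF | hF
  · exact ⟨hadj, hq⟩
  · -- a forward `e`-step, `e ≠ e₀`: its first endpoint is the inner or the outer one, both impossible
    exfalso
    obtain ⟨heF, hne⟩ := hF
    obtain ⟨y, z, hor, hy, hz⟩ := exists_endpoints hconn (hneeded _ heF)
    have hy₀ := in_not_mem_side hconn (hneeded _ he₀) (hneeded _ heF) hne (hmin _ heF) hor hz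
    have hz₀ : z ∉ side H O F b e₀ := fun h ↦ hz (hmin _ heF h)
    rcases hor with h | h
    · simp only [Prod.mk.injEq] at h; exact hy₀ (h.1 ▸ hp)
    · simp only [Prod.mk.injEq] at h; exact hz₀ (h.1 ▸ hp)
  · exfalso
    obtain ⟨heF, hne⟩ := hF
    obtain ⟨y, z, hor, hy, hz⟩ := exists_endpoints hconn (hneeded _ heF)
    have hy₀ := in_not_mem_side hconn (hneeded _ he₀) (hneeded _ heF) hne (hmin _ heF) hor hz
    have hz₀ : z ∉ side H O F b e₀ := fun h ↦ hz (hmin _ heF h)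
    rcases hor with h | h
    · simp only [Prod.mk.injEq] at h; exact hz₀ (h.2 ▸ hp)
    · simp only [Prod.mk.injEq] at h; exact hy₀ (h.2 ▸ hp)

/-- **`b` is joined to the inner endpoint of the edge of smallest side.** -/
theorem pathIn_inP_of_isMin (hconn : Relation.ReflTransGen (fun a c ↦ (a, c) ∈ bAugSteps H O F) b b')
    (hneeded : ∀ e ∈ F, b' ∉ side H O F b e) (hb : b ∈ O) {e₀ : V × V}
    (he₀ : e₀ ∈ F) (hmin : ∀ e ∈ F, side H O F b e₀ ⊆ side H O F b e) {y z : V}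
    (hy : y ∈ side H O F b e₀) (_hor : (y, z) = e₀ ∨ (z, y) = e₀) :
    PathIn H O b y := by
  have h := bAugChain_restrict hy
  refine pathIn_of_restricted (P := {p | ¬ Relation.ReflTransGen
    (fun a c ↦ (a, c) ∈ bAugSteps H O (F \ {e₀})) b p}) h hb fun p q hpq hp _ ↦ ?_
  simp only [mem_setOf_eq, not_not] at hp
  exact real_of_step_below hconn hneeded he₀ hmin hpq hp

/-- Matching two orientations of the same edge: the first endpoint of one is an endpoint of the other. -/
theorem fst_eq_or_of_orient {f : V × V} {p q y z : V} (h₁ : (p, q) = f ∨ (q, p) = f)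
    (h₂ : (y, z) = f ∨ (z, y) = f) : y = p ∨ y = q := by
  rcases h₁ with rfl | rfl <;> rcases h₂ with h | h <;> simp only [Prod.mk.injEq] at h
  exacts [Or.inl h.1, Or.inr h.2, Or.inr h.1, Or.inl h.2]

/-- **Steps above the highest side are real**: for the edge of largest side, a step of the full augmentation between
two points outside its side is a real open edge. -/
theorem real_of_step_above (hconn : Relation.ReflTransGen (fun a c ↦ (a, c) ∈ bAugSteps H O F) b b')
    (hneeded : ∀ e ∈ F, b' ∉ side H O F b e) {e₁ : V × V}
    (hmax : ∀ e ∈ F, side H O F b e ⊆ side H O F b e₁) {p q : V}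
    (hpq : (p, q) ∈ bAugSteps H O F) (hp : p ∉ side H O F b e₁) (hq : q ∉ side H O F b e₁) :
    H.Adj p q ∧ q ∈ O := by
  -- an `f`-step, `f ∈ F`, has its inner endpoint (if `f = e₁`) or both endpoints (if `f ≠ e₁`) in `S_{e₁}`
  have key : ∀ f ∈ F, ((p, q) = f ∨ (q, p) = f) → False := by
    intro f hfF hpq'
    obtain ⟨y, z, hor, hy, hz⟩ := exists_endpoints hconn (hneeded _ hfF)
    have hy₁ : y ∈ side H O F b e₁ := hmax _ hfF hy
    rcases fst_eq_or_of_orient hpq' hor with rfl | rfl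
    · exact hp hy₁
    · exact hq hy₁
  rcases hpq with ⟨hadj, -, hq'⟩ | hF | hF
  · exact ⟨hadj, hq'⟩
  · exact (key _ hF (Or.inl rfl)).elim
  · exact (key _ hF (Or.inr rfl)).elim

/-- **The outer endpoint of the edge of largest side is joined to `b'`.** -/
theorem pathIn_outP_of_isMax (hconn : Relation.ReflTransGen (fun a c ↦ (a, c) ∈ bAugSteps H O F) b b')
    (hneeded : ∀ e ∈ F, b' ∉ side H O F b e) (hO : ∀ e ∈ F, e.1 ∈ O ∧ e.2 ∈ O)
    {e₁ : V × V} (he₁ : e₁ ∈ F) (hmax : ∀ e ∈ F, side H O F b e ⊆ side H O F b e₁) {y z : V}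
    (hor : (y, z) = e₁ ∨ (z, y) = e₁) (hy : y ∈ side H O F b e₁) (hz : z ∉ side H O F b e₁) :
    PathIn H O z b' := by
  obtain ⟨y', z', hy', hz', hs, -, hrest⟩ :=
    exists_last_exit (P := side H O F b e₁) hconn (Relation.ReflTransGen.refl) (hneeded _ he₁)
  -- the last exit step is `e₁`, landing at `z`
  have hor' := step_eq_of_exit hs hy' hz'
  have hzz : z' = z := by
    rcases hor with h | h <;> rcases hor' with h' | h' <;>
      have hh := h.trans h'.symm <;> simp only [Prod.mk.injEq] at hh
    · exact hh.2.symm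
    · exact absurd (hh.1 ▸ hy) hz'
    · exact absurd (hh.2 ▸ hy) hz'
    · exact hh.1.symm
  subst hzz
  have hzO : z' ∈ O := by
    rcases hor with h | h
    · exact (h ▸ (hO _ he₁)).2
    · exact (h ▸ (hO _ he₁)).1
  exact pathIn_of_restricted hrest hzO fun p q hpq hp hq ↦ real_of_step_above hconn hneeded hmax hpq hp hq

/-- **Steps of a middle band are real**: for consecutive needed edges `e < e'` (no side strictly in between), a step
of the augmentation by `F ∖ {e'}` between two points of `S_{e'} ∖ S_e` is a real open edge. -/
theorem real_of_step_between (hconn : Relation.ReflTransGen (fun a c ↦ (a, c) ∈ bAugSteps H O F) b b')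
    (hneeded : ∀ e ∈ F, b' ∉ side H O F b e) {e e' : V × V} (he' : e' ∈ F)
    (hcov : ∀ e'' ∈ F, side H O F b e'' ⊆ side H O F b e ∨ side H O F b e' ⊆ side H O F b e'')
    {p q : V} (hpq : (p, q) ∈ bAugSteps H O (F \ {e'})) (hp : p ∉ side H O F b e)
    (hp' : p ∈ side H O F b e') (hq : q ∉ side H O F b e) (hq' : q ∈ side H O F b e') :
    H.Adj p q ∧ q ∈ O := by
  have key : ∀ f ∈ F, f ≠ e' → ((p, q) = f ∨ (q, p) = f) → False := by
    intro f hfF hne' hpq'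
    obtain ⟨y, z, hor, hy, hz⟩ := exists_endpoints hconn (hneeded _ hfF)
    rcases hcov _ hfF with hle | hle
    · -- side below `S_e`: the inner endpoint is in `S_e`
      have hy₁ : y ∈ side H O F b e := hle hy
      rcases fst_eq_or_of_orient hpq' hor with rfl | rfl
      · exact hp hy₁
      · exact hq hy₁
    · -- side above `S_{e'}`: the inner endpoint is outside `S_{e'}`
      have hy₁ : y ∉ side H O F b e' := in_not_mem_side hconn (hneeded _ he') (hneeded _ hfF) hne' hle hor hz
      rcases fst_eq_or_of_orient hpq' hor with rfl | rfl
      · exact hy₁ hp'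
      · exact hy₁ hq'
  rcases hpq with ⟨hadj, -, hqO⟩ | ⟨hF, hne'⟩ | ⟨hF, hne'⟩
  · exact ⟨hadj, hqO⟩
  · exact (key _ hF hne' (Or.inl rfl)).elim
  · exact (key _ hF hne' (Or.inr rfl)).elim

/-- **Consecutive clusters touch**: for consecutive needed edges `e < e'`, the outer endpoint of `e` is joined by an
open path of `O` to the inner endpoint of `e'`. -/
theorem pathIn_outP_inP_of_covBy (hconn : Relation.ReflTransGen (fun a c ↦ (a, c) ∈ bAugSteps H O F) b b')
    (hneeded : ∀ e ∈ F, b' ∉ side H O F b e) (hO : ∀ e ∈ F, e.1 ∈ O ∧ e.2 ∈ O)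
    {e e' : V × V} (he : e ∈ F) (he' : e' ∈ F) (hne : e ≠ e')
    (hlt : side H O F b e ⊆ side H O F b e')
    (hcov : ∀ e'' ∈ F, side H O F b e'' ⊆ side H O F b e ∨ side H O F b e' ⊆ side H O F b e'')
    {y z y' z' : V} (hor : (y, z) = e ∨ (z, y) = e) (hy : y ∈ side H O F b e) (hz : z ∉ side H O F b e)
    (hor' : (y', z') = e' ∨ (z', y') = e') (hy' : y' ∈ side H O F b e') (hz' : z' ∉ side H O F b e') :
    PathIn H O z y' := by
  -- last exit from `P = S_e ∪ (S_{e'})ᶜ` along a chain `b ⟶ y'` over `F ∖ {e'}`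
  set P : Set V := side H O F b e ∪ (side H O F b e')ᶜ with hP
  have hbP : b ∈ P := Or.inl Relation.ReflTransGen.refl
  have hy'P : y' ∉ P := by
    rintro (h | h)
    · exact in_not_mem_side hconn (hneeded _ he) (hneeded _ he') hne.symm hlt hor' hz' h
    · exact h hy'
  obtain ⟨u, v, huP, hvP, hs, hbu, hrest⟩ := exists_last_exit (P := P) hy' hbP hy'P
  -- the exit step is the `e`-step to `z`
  have hu' : u ∈ side H O F b e' := hbu
  have hu : u ∈ side H O F b e := huP.resolve_right fun h ↦ h hu'
  have hv : v ∉ side H O F b e := fun h ↦ hvP (Or.inl h)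
  have horuv := step_eq_of_exit (bAugSteps_mono' hs) hu hv
  have hvz : v = z := by
    rcases hor with h | h <;> rcases horuv with h' | h' <;>
      have hh := h.trans h'.symm <;> simp only [Prod.mk.injEq] at hh
    · exact hh.2.symm
    · exact absurd (hh.1 ▸ hy) hv
    · exact absurd (hh.2 ▸ hy) hv
    · exact hh.1.symm
  subst hvz
  have hvO : v ∈ O := by
    rcases hor with h | h
    · exact (h ▸ (hO _ he)).2
    · exact (h ▸ (hO _ he)).1
  refine pathIn_of_restricted hrest hvO fun p q hpq hp hq ↦ ?_
  simp only [hP, mem_union, mem_compl_iff, not_or, not_not] at hp hq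
  exact real_of_step_between hconn hneeded he' hcov hpq hp.1 hp.2 hq.1 hq.2
where
  /-- Steps over a sub-family are steps over the family. -/
  bAugSteps_mono' {G : Set (V × V)} {e' : V × V} {p : V × V}
      (h : p ∈ bAugSteps H O (G \ {e'})) : p ∈ bAugSteps H O G := by
    rcases h with h | h | h
    · exact Or.inl h
    · exact Or.inr (Or.inl h.1)
    · exact Or.inr (Or.inr h.1)

/-- **Distinct clusters, I**: `b` is not joined to any outer endpoint. -/
theorem not_pathIn_b_outP {e : V × V} {z : V} (hz : z ∉ side H O F b e) :
    ¬ PathIn H O b z := fun h ↦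
  hz ((bAugChain_iff_of_pathIn (F \ {e}) h).1 Relation.ReflTransGen.refl)

/-- **Distinct clusters, II**: for needed `e ≠ e'` with `S_e ⊆ S_{e'}`, the outer endpoints of `e` and `e'` are not
joined. -/
theorem not_pathIn_outP_outP_of_lt (hconn : Relation.ReflTransGen (fun a c ↦ (a, c) ∈ bAugSteps H O F) b b')
    {e e' : V × V} (he : b' ∉ side H O F b e) (he' : b' ∉ side H O F b e') (hne : e ≠ e')
    (hS : side H O F b e ⊆ side H O F b e') {y z z' : V} (hor : (y, z) = e ∨ (z, y) = e)
    (hy : y ∈ side H O F b e) (hz' : z' ∉ side H O F b e') :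
    ¬ PathIn H O z z' := fun h ↦
  hz' ((bAugChain_iff_of_pathIn (F \ {e'}) h).1 (out_mem_side hconn he he' hne hS hor hy))

/-! ## §3 Ranks and the packaged chain form -/

/-- Sides lie inside `{b} ∪ O`, if the edges of `F` have their endpoints in `O`. -/
theorem side_subset_insert (hO : ∀ e ∈ F, e.1 ∈ O ∧ e.2 ∈ O) (e : V × V) :
    side H O F b e ⊆ insert b O := by
  intro v hv
  induction hv with
  | refl => exact mem_insert _ _
  | @tail y z _ hyz _ =>
    refine mem_insert_of_mem _ ?_
    rcases hyz with ⟨-, -, hz⟩ | hF | hF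
    · exact hz
    · exact (hO _ hF.1).2
    · exact (hO _ hF.1).1

/-- **Ranks order the sides**: for needed edges and a finite region, `|S_e| ≤ |S_{e'}|` iff `S_e ⊆ S_{e'}`. -/
theorem side_subset_iff_ncard_le (hfin : O.Finite)
    (hconn : Relation.ReflTransGen (fun a c ↦ (a, c) ∈ bAugSteps H O F) b b')
    (hO : ∀ e ∈ F, e.1 ∈ O ∧ e.2 ∈ O) {e e' : V × V}
    (he : b' ∉ side H O F b e) (he' : b' ∉ side H O F b e') :
    side H O F b e ⊆ side H O F b e' ↔ (side H O F b e).ncard ≤ (side H O F b e').ncard := by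
  have hfin' : ∀ f, (side H O F b f).Finite := fun f ↦ (hfin.insert b).subset (side_subset_insert hO f)
  refine ⟨fun h ↦ ncard_le_ncard h (hfin' e'), fun h ↦ ?_⟩
  rcases side_subset_or_subset hconn he he' with h' | h'
  · exact h'
  · exact (eq_of_subset_of_ncard_le h' h (hfin' e)).symm.subset

/-- **The chain form, packaged**: for a finite region `O`, a family `F` of virtual edges with endpoints in `O` over which
`b ∈ O` and `b'` are chained, every edge being needed, there are a rank `rk` injective on `F` and inner/outer endpoints
`inP e, outP e` (`e = (inP e, outP e)` or `(outP e, inP e)`) such that `b ⟶ inP e_min`, `outP e ⟶ inP e'` for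
rank-consecutive `e, e'`, `outP e_max ⟶ b'` by `H`-paths of `O`, while `b ≁ outP e` and `outP e ≁ outP e'` (`rk e < rk e'`). -/
theorem exists_rank_of_needed (hfin : O.Finite)
    (hconn : Relation.ReflTransGen (fun a c ↦ (a, c) ∈ bAugSteps H O F) b b')
    (hneeded : ∀ e ∈ F, ¬ Relation.ReflTransGen (fun a c ↦ (a, c) ∈ bAugSteps H O (F \ {e})) b b')
    (hO : ∀ e ∈ F, e.1 ∈ O ∧ e.2 ∈ O) (hb : b ∈ O) :
    ∃ (rk : V × V → ℕ) (inP outP : V × V → V), Set.InjOn rk F ∧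
      (∀ e ∈ F, (inP e, outP e) = e ∨ (outP e, inP e) = e) ∧
      (∀ e ∈ F, (∀ e' ∈ F, rk e ≤ rk e') → PathIn H O b (inP e)) ∧
      (∀ e ∈ F, (∀ e' ∈ F, rk e' ≤ rk e) → PathIn H O (outP e) b') ∧
      (∀ e ∈ F, ∀ e' ∈ F, rk e < rk e' → (∀ e'' ∈ F, rk e'' ≤ rk e ∨ rk e' ≤ rk e'') →
        PathIn H O (outP e) (inP e')) ∧
      (∀ e ∈ F, ¬ PathIn H O b (outP e)) ∧
      (∀ e ∈ F, ∀ e' ∈ F, rk e < rk e' → ¬ PathIn H O (outP e) (outP e')) := by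
  classical
  -- adapted from `zCovering_A_chain` (`…NeckZ2CoveringAChain`)
  have hnd : ∀ e ∈ F, b' ∉ side H O F b e := fun e he ↦ hneeded e he
  have key : ∀ e ∈ F, ∃ y z, ((y, z) = e ∨ (z, y) = e) ∧ y ∈ side H O F b e ∧ z ∉ side H O F b e :=
    fun e he ↦ exists_endpoints hconn (hnd e he)
  haveI : Nonempty V := ⟨b⟩
  choose! inP outP hor hin hout using key
  set rk : V × V → ℕ := fun e ↦ (side H O F b e).ncard with hrk
  have hle : ∀ e ∈ F, ∀ e' ∈ F, rk e ≤ rk e' ↔ side H O F b e ⊆ side H O F b e' :=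
    fun e he e' he' ↦ (side_subset_iff_ncard_le hfin hconn hO (hnd e he) (hnd e' he')).symm
  have hlt : ∀ e ∈ F, ∀ e' ∈ F, rk e < rk e' → side H O F b e ⊆ side H O F b e' ∧ e ≠ e' :=
    fun e he e' he' h ↦ ⟨(hle e he e' he').1 h.le, fun heq ↦ by subst heq; exact lt_irrefl _ h⟩
  refine ⟨rk, inP, outP, ?_, hor, ?_, ?_, ?_, ?_, ?_⟩
  · intro e he e' he' h
    by_contra hne'
    exact side_ne_side hconn (hnd e he) (hnd e' he') hne'
      (((hle e he e' he').1 h.le).antisymm ((hle e' he' e he).1 h.ge))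
  · intro e he hmin
    exact pathIn_inP_of_isMin hconn hnd hb he (fun e' he' ↦ (hle e he e' he').1 (hmin e' he')) (hin e he) (hor e he)
  · intro e he hmax
    exact pathIn_outP_of_isMax hconn hnd hO he (fun e' he' ↦ (hle e' he' e he).1 (hmax e' he')) (hor e he) (hin e he)
      (hout e he)
  · intro e he e' he' h hcov
    obtain ⟨hS, hne'⟩ := hlt e he e' he' h
    refine pathIn_outP_inP_of_covBy hconn hnd hO he he' hne' hS (fun e'' he'' ↦ ?_) (hor e he) (hin e he) (hout e he)
      (hor e' he') (hin e' he') (hout e' he')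
    rcases hcov e'' he'' with h'' | h''
    · exact Or.inl ((hle e'' he'' e he).1 h'')
    · exact Or.inr ((hle e' he' e'' he'').1 h'')
  · exact fun e he ↦ not_pathIn_b_outP (hout e he)
  · intro e he e' he' h
    obtain ⟨hS, hne'⟩ := hlt e he e' he' h
    exact not_pathIn_outP_outP_of_lt hconn (hnd e he) (hnd e' he') hne' hS (hor e he) (hin e he) (hout e' he')

end NeckBridge

/-- **The necklace of real clusters along a needed family (registered helper, anchor of this module on the crux item;
closed form of `NeckBridge.exists_rank_of_needed`).** -/
theorem bridge_exists_rank_of_needed : ∀ (V : Type) (H : SimpleGraph V) (O : Set V) (F : Set (V × V)) (b b' : V), O.Finite → Relation.ReflTransGen (fun a c ↦ (a, c) ∈ NeckBridge.bAugSteps H O F) b b' → (∀ e ∈ F, ¬ Relation.ReflTransGen (fun a c ↦ (a, c) ∈ NeckBridge.bAugSteps H O (F \ {e})) b b') → (∀ e ∈ F, e.1 ∈ O ∧ e.2 ∈ O) → b ∈ O → ∃ (rk : V × V → ℕ) (inP outP : V × V → V), Set.InjOn rk F ∧ (∀ e ∈ F, (inP e, outP e) = e ∨ (outP e, inP e) =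 e) ∧ (∀ e ∈ F, (∀ e' ∈ F, rk e ≤ rk e') → PathIn H O b (inP e)) ∧ (∀ e ∈ F, (∀ e' ∈ F, rk e' ≤ rk e) → PathIn H O (outP e) b') ∧ (∀ e ∈ F, ∀ e' ∈ F, rk e < rk e' → (∀ e'' ∈ F, rk e'' ≤ rk e ∨ rk e' ≤ rk e'') → PathIn H O (outP e) (inP e')) ∧ (∀ e ∈ F, ¬ PathIn H O b (outP e)) ∧ (∀ e ∈ F, ∀ e' ∈ F, rk e < rk e' → ¬ PathIn H O (outP e) (outP e')) :=
  fun _ _ _ _ _ _ hfin hconn hneeded hO hb ↦ NeckBridge.exists_rank_of_needed hfin hconn hneeded hO hb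

end Summit.CriticalPhenomena.CardyFormulaZ2.Cruxes.NestingRigidity.PinchResampling
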